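import Literature.AlgebraicGeometry.Motives.FaltingsECTateFiniteProofs
import Literature.AlgebraicGeometry.Motives.FaltingsECProofs
import Literature.AlgebraicGeometry.Motives.FaltingsECTateLemma1Proofs
import Literature.NumberTheory.EllipticCurves.IsogenyGeomEndRingProofs
import Literature.NumberTheory.EllipticCurves.DivisionPolynomialMultiplication
import Literature.NumberTheory.EllipticCurves.DivisionPolynomialTorsion
import Literature.NumberTheory.EllipticCurves.TorsionCardinality
import Mathlib.Algebra.Order.Archimedean.Basic
import HarnessLib

/-!
# A Frobenius acting on `T_ℓ E` as an `ℓ`-adic scalar is an integer (Tate's theorem, central case)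

Sibling file of `Literature.AlgebraicGeometry.Motives.FaltingsEC` (D-0014), serving the named
fact `Literature.AlgebraicGeometry.Motives.mem_span_range_tateEndRingHom_iff_of_finite` (Tate, Invent. Math. 2 (1966),
Main Theorem, `End` form, for an elliptic curve over a finite field). The tree proves that fact
when the arithmetic Frobenius `σ_q` is *not* an `ℓ`-adic scalar on `T_ℓ E`
(`FaltingsECTateFiniteEndProofs`); the remaining, *central* case is the one in which
`σ_q = c ∈ ℤ_ℓ` on `T_ℓ E`. In Tate's and Waterhouse's analysis this is the case
`h_A = P_A = (X - b)²`, `b = ±√q ∈ ℤ`, of a supersingular curve all of whose endomorphisms are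
defined over `k` (Waterhouse, Ann. Sci. ÉNS 2 (1969), Thm. 4.1, case (2), and its proof); that the
`ℓ`-adic scalar `c` is then the rational integer `b`, i.e. that the `q`-power Frobenius
endomorphism `π` of `E` *is multiplication by an integer on `E(k̄)`*, is usually read off from the
injectivity of `ℤ_ℓ ⊗ End_k(E) → End(T_ℓ E)` (Silverman, *AEC*, Thm. III.7.4) or from the
integrality of the characteristic polynomial of Frobenius (*AEC* V.2.3.1), neither of which the
tree has in the points model of `Literature.NumberTheory.EllipticCurves.Isogeny`.

This file proves it directly, by **counting points with division polynomials**: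

* `Literature.AlgebraicGeometry.Motives.exists_int_frobenius_smul_eq_zsmul`: for `E` elliptic over a finite field `k` with
  `q` elements, `ℓ ≠ char k`, and `σ_q = c` on `T_ℓ E` (`c ∈ ℤ_ℓ`), there is `m ∈ ℤ` with
  `σ_q P = m P` for **all** `P ∈ E(k̄)`.

## The proof

Choose `N` with `ℓ ^ N > 4q + 2` and an integer `m ≡ c (mod ℓ ^ N)` with `2|m| ≤ ℓ ^ N`
(`exists_int_two_mul_abs_le_and_eq_add`); then `σ_q = m` on `E[ℓ^N]`
(`smul_eq_zsmul_of_mem_geomTorsion`, the projections `T_ℓ E → E[ℓ^N]` being onto), and `ℓ ∤ m`.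
The endomorphisms `π ∓ [m]` of `E` over `k` are `0` or isogenies (*AEC* III.§4, the tree's
`mem_geomEndRing_iff_holds`), so either `π = ±[m]` on `E(k̄)` — the claim — or both kernels
`A = {P | σ_q P = m P}`, `B = {P | σ_q P = -m P}` are finite. In the latter case consider
`G = X ^ q · ΨSq_m - Φ_m ∈ k̄[X]`, where `x([m]P) = Φ_m(x)/ΨSq_m(x)` (Silverman, *AEC*,
Exercise 3.7(d); the tree's `zsmul_some_eq_some_φ_div`) and `x(σ_q P) = x(P) ^ q`: an affine point
`P ∉ E[m]` lies in `A ∪ B` iff `x(P)` is a root of `G` (`±` because the `x`-coordinate determines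
a point up to sign).
* If `G = 0`, every point off `E[m]` is in the finite set `A ∪ B`, so the subgroup `E[m]` has
  finite complement and is all of `E(k̄)`; but `E[ℓ] ≅ (ℤ/ℓ)²` has a non-zero point, which is not
  killed by `m` (`gcd(m, ℓ) = 1`).
* If `G ≠ 0`, then `E[ℓ^N] ⊆ A` gives
  `ℓ^{2N} = #E[ℓ^N] ≤ #A ≤ 1 + 2 · #roots(G) ≤ 1 + 2(q + m²) ≤ 1 + 2q + ℓ^{2N}/2`,
  i.e. `ℓ^{2N} ≤ 4q + 2 < ℓ^N`, absurd.

## References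

* [Tate1966Endomorphisms] J. Tate, *Endomorphisms of abelian varieties over finite fields*,
  Invent. Math. 2 (1966), 134–144, Main Theorem and §2.
* [Waterhouse1969] W. C. Waterhouse, *Abelian varieties over finite fields*, Ann. Sci. ÉNS (4) 2
  (1969), 521–560, Ch. 2 and Thm. 4.1 (case (2): `β = ±2√q`, "have all their endomorphisms
  defined over `k`"; proof: `h_A = P_A = (X - b)²`).
* [SilvermanAEC2009] J. H. Silverman, *The Arithmetic of Elliptic Curves*, 2nd ed., GTM 106,
  Exercise 3.7(d),(f) (multiplication by `m` via division polynomials), Cor. III.6.4(b)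
  (`#E[ℓ^n] = ℓ^{2n}`), III.§4 and III.§7.
-/

noncomputable section

open scoped Classical

universe u

namespace Literature.AlgebraicGeometry.Motives

open WeierstrassCurve Polynomial

variable {K : Type u} [Field K]

/-! ## Arithmetic preliminaries -/

/-- Every `ℓ`-adic integer `c` is congruent modulo `ℓ ^ n` to a rational integer `m` with
`2|m| ≤ ℓ ^ n` (the balanced residue of `c mod ℓ ^ n`). [folklore] -/
theorem exists_int_two_mul_abs_le_and_eq_add (ℓ : ℕ) [Fact ℓ.Prime] (c : ℤ_[ℓ]) (n : ℕ) :
    ∃ (m : ℤ) (w : ℤ_[ℓ]), 2 * |m| ≤ (ℓ : ℤ) ^ n ∧ c = (m : ℤ_[ℓ]) + (ℓ : ℤ_[ℓ]) ^ n * w := by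
  haveI : NeZero (ℓ ^ n) := ⟨pow_ne_zero _ (Fact.out : ℓ.Prime).ne_zero⟩
  set v : ℕ := (PadicInt.toZModPow n c).val with hv
  have hvlt : v < ℓ ^ n := ZMod.val_lt _
  have hmem : c - (v : ℤ_[ℓ]) ∈ RingHom.ker (PadicInt.toZModPow n) := by
    rw [RingHom.mem_ker, map_sub, map_natCast, hv, ZMod.natCast_zmod_val, sub_self]
  rw [PadicInt.ker_toZModPow, Ideal.mem_span_singleton'] at hmem
  obtain ⟨w, hw⟩ := hmem
  by_cases h2 : 2 * v ≤ ℓ ^ n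
  · refine ⟨v, w, ?_, ?_⟩
    · rw [Nat.abs_cast]
      exact_mod_cast h2
    · rw [Int.cast_natCast, mul_comm, hw, add_sub_cancel]
  · refine ⟨(v : ℤ) - (ℓ : ℤ) ^ n, w + 1, ?_, ?_⟩
    · have hneg : (v : ℤ) - (ℓ : ℤ) ^ n < 0 := by
        have : (v : ℤ) < (ℓ : ℤ) ^ n := by exact_mod_cast hvlt
        linarith
      rw [abs_of_neg hneg]
      push Not at h2
      have h2' : (ℓ : ℤ) ^ n < 2 * (v : ℤ) := by exact_mod_cast h2
      linarith
    · rw [mul_add, mul_one, mul_comm, hw]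
      push_cast
      ring

variable (W : WeierstrassCurve K) (ℓ : ℕ) [Fact ℓ.Prime]

/-- If `σ ∈ Γ_K` acts on `T_ℓ E` as the `ℓ`-adic scalar `c`, and `c ≡ m (mod ℓ ^ n)` for an
integer `m`, then `σ` acts on `E[ℓ^n]` as multiplication by `m` (the projection `T_ℓ E → E[ℓ^n]`
is onto for an elliptic curve, the tree's `exists_proj_tateModule_eq`). Silverman, *AEC*, III.§7.
[folklore] -/
theorem smul_eq_zsmul_of_mem_geomTorsion [W.IsElliptic] {σ : Field.absoluteGaloisGroup K}
    {c : ℤ_[ℓ]} (hπ : ∀ x : W.tateModule ℓ, σ • x = c • x) {n : ℕ} {m : ℤ} {w : ℤ_[ℓ]}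
    (hc : c = (m : ℤ_[ℓ]) + (ℓ : ℤ_[ℓ]) ^ n * w) {P : W.geomPoints}
    (hP : P ∈ geomTorsion W (ℓ ^ n : ℕ)) : σ • P = m • P := by
  obtain ⟨x, rfl⟩ := exists_proj_tateModule_eq ℓ n hP
  rw [← Literature.NumberTheory.EllipticCurves.TateModule.proj_smul_of_distribMulAction, hπ, hc, add_smul, map_add,
    Literature.NumberTheory.EllipticCurves.TateModule.proj_intCast_smul, mul_smul, Literature.NumberTheory.EllipticCurves.TateModule.proj_pow_smul, Literature.NumberTheory.EllipticCurves.TateModule.pow_smul_proj,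
    add_zero]

/-- For an elliptic curve and a prime `ℓ ≠ char K` there is a non-zero `ℓ`-torsion point on
`E(K̄)` (`#E[ℓ] = ℓ² > 1`, Silverman, *AEC*, Cor. III.6.4(b), the tree's
`card_geomTorsion_pow_eq`). [cite: SilvermanAEC2009, Cor. III.6.4(b)] -/
theorem exists_mem_geomTorsion_ne_zero [W.IsElliptic] (hℓ : (ℓ : K) ≠ 0) :
    ∃ P ∈ geomTorsion W (ℓ : ℕ), P ≠ 0 := by
  have hℓp : ℓ.Prime := Fact.out
  have hcard : Nat.card (geomTorsion W (ℓ ^ 1 : ℕ)) = ℓ ^ (2 * 1) :=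
    card_geomTorsion_pow_eq W ℓ (card_torsionPoints_eq_sq_holds W (AlgebraicClosure K)) hℓ 1
  rw [pow_one, mul_one] at hcard
  haveI : Finite (geomTorsion W (ℓ : ℕ)) :=
    Nat.finite_of_card_ne_zero (by rw [hcard]; exact pow_ne_zero _ hℓp.ne_zero)
  have h1 : 1 < Nat.card (geomTorsion W (ℓ : ℕ)) := by
    rw [hcard]
    exact Nat.one_lt_pow two_ne_zero hℓp.one_lt
  haveI : Nontrivial (geomTorsion W (ℓ : ℕ)) := Finite.one_lt_card_iff_nontrivial.mp h1
  obtain ⟨⟨P, hP⟩, hP0⟩ := exists_ne (0 : geomTorsion W (ℓ : ℕ))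
  exact ⟨P, hP, fun h ↦ hP0 (Subtype.ext h)⟩

/-- The Galois action on an affine geometric point is the action on its coordinates.
[folklore] -/
theorem smul_some_eq_some (σ : Field.absoluteGaloisGroup K) {x y : AlgebraicClosure K}
    (h : (W.baseChange (AlgebraicClosure K)).toAffine.Nonsingular x y) :
    ∃ h', σ • (show W.geomPoints from Affine.Point.some x y h) =
      (Affine.Point.some (σ • x) (σ • y) h' : W.geomPoints) :=
  ⟨_, rfl⟩

/-! ## The theorem -/

/-- **A Frobenius acting on `T_ℓ E` as an `ℓ`-adic scalar acts on `E(k̄)` as an integer.** Let `E`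
be an elliptic curve over a finite field `k` with `q` elements, `ℓ` a prime with `ℓ ≠ 0` in `k`,
`σ_q ∈ Γ_k` the arithmetic Frobenius (`σ_q x = x ^ q` on `k̄`), and suppose `σ_q` acts on
`T_ℓ E` as a scalar `c ∈ ℤ_ℓ`. Then there is an integer `m` with `σ_q P = m P` for every
`P ∈ E(k̄)`: the `q`-power Frobenius endomorphism of `E` is multiplication by `m` (so
`c = m`, `m = ±√q`, and `E` is supersingular with all its endomorphisms defined over `k`:
Waterhouse, Ann. Sci. ÉNS 2 (1969), Thm. 4.1, case (2), proof — "`h_A = P_A = (X - b)²`";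
Tate, Invent. Math. 2 (1966), §2, the case `π ∈ F` central). The proof (module docstring) counts
the points `P` with `σ_q P = m P` for a balanced lift `m` of `c mod ℓ ^ N` by means of the
polynomial `X ^ q ΨSq_m - Φ_m` (Silverman, *AEC*, Exercise 3.7(d): `x([m]P) = Φ_m/ΨSq_m`).
[cite: Waterhouse1969, Thm. 4.1 (case (2)) and its proof] -/
theorem exists_int_frobenius_smul_eq_zsmul [Finite K] [W.IsElliptic] (hℓ : (ℓ : K) ≠ 0)
    {σ : Field.absoluteGaloisGroup K} (hσ : ∀ x : AlgebraicClosure K, σ • x = x ^ Nat.card K)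
    {c : ℤ_[ℓ]} (hπ : ∀ x : W.tateModule ℓ, σ • x = c • x) :
    ∃ m : ℤ, ∀ P : W.geomPoints, σ • P = m • P := by
  have hℓp : ℓ.Prime := Fact.out
  set q : ℕ := Nat.card K with hq
  -- a level `N ≥ 1` with `ℓ ^ N > 4q + 2`
  obtain ⟨N, hN⟩ : ∃ N : ℕ, 4 * q + 2 < ℓ ^ N := pow_unbounded_of_one_lt _ hℓp.one_lt
  have hN1 : 1 ≤ N := by
    rcases Nat.eq_zero_or_pos N with rfl | h
    · rw [pow_zero] at hN
      omega
    · exact h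
  -- a balanced integer lift `m` of `c mod ℓ ^ N`
  obtain ⟨m, w, hm2, hcm⟩ := exists_int_two_mul_abs_le_and_eq_add ℓ c N
  -- `σ = m` on `E[ℓ^N]`
  have htor : ∀ P ∈ geomTorsion W (ℓ ^ N : ℕ), σ • P = m • P := fun P hP ↦
    smul_eq_zsmul_of_mem_geomTorsion W ℓ hπ hcm hP
  -- a non-zero point of order `ℓ`; it lies in `E[ℓ^N]`
  obtain ⟨P₁, hP₁, hP₁0⟩ := exists_mem_geomTorsion_ne_zero W ℓ hℓ
  have hP₁ℓ : (ℓ : ℤ) • P₁ = 0 := (Submodule.mem_torsionBy_iff _ _).mp hP₁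
  have hP₁N : P₁ ∈ geomTorsion W (ℓ ^ N : ℕ) := by
    refine (Submodule.mem_torsionBy_iff _ _).mpr ?_
    obtain ⟨N', rfl⟩ := Nat.exists_eq_add_of_le' hN1
    change ((ℓ ^ (N' + 1) : ℕ) : ℤ) • P₁ = 0
    rw [pow_succ, Nat.cast_mul, mul_smul, hP₁ℓ, smul_zero]
  -- `ℓ ∤ m`
  have hℓm : ¬ (ℓ : ℤ) ∣ m := by
    rintro ⟨k, rfl⟩
    have h1 : σ • P₁ = 0 := by
      rw [htor P₁ hP₁N, mul_comm, mul_smul, hP₁ℓ, smul_zero]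
    exact hP₁0 ((smul_eq_zero_iff_eq σ).mp h1)
  -- the endomorphisms `π ∓ [m]`
  set π : AddMonoid.End W.geomPoints := (W.frobeniusIsogeny hσ).toAddMonoidHom with hπdef
  have hπapp : ∀ P : W.geomPoints, π P = σ • P := fun P ↦ rfl
  have hπmem : π ∈ W.endRing := (W.frobeniusIsogeny hσ).toAddMonoidHom_mem_endRing
  have hmemA : π - (m : AddMonoid.End W.geomPoints) ∈ W.endRing :=
    sub_mem hπmem (intCast_mem _ m)
  have hmemB : π + (m : AddMonoid.End W.geomPoints) ∈ W.endRing :=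
    add_mem hπmem (intCast_mem _ m)
  rcases eq_zero_or_exists_isogeny_of_mem_endRing W (mem_geomEndRing_iff_holds W) hmemA with
    hA0 | ⟨χA, hχA⟩
  · refine ⟨m, fun P ↦ ?_⟩
    have h : (π - (m : AddMonoid.End W.geomPoints)) P = 0 := by rw [hA0]; rfl
    change π P - (m : AddMonoid.End W.geomPoints) P = 0 at h
    rwa [hπapp, AddMonoid.End.intCast_apply, sub_eq_zero] at h
  rcases eq_zero_or_exists_isogeny_of_mem_endRing W (mem_geomEndRing_iff_holds W) hmemB with
    hB0 | ⟨χB, hχB⟩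
  · refine ⟨-m, fun P ↦ ?_⟩
    have h : (π + (m : AddMonoid.End W.geomPoints)) P = 0 := by rw [hB0]; rfl
    change π P + (m : AddMonoid.End W.geomPoints) P = 0 at h
    rw [hπapp, AddMonoid.End.intCast_apply] at h
    rw [neg_smul]
    exact eq_neg_of_add_eq_zero_left h
  exfalso
  -- both kernels are finite
  have hAfin : {P : W.geomPoints | σ • P = m • P}.Finite := by
    refine χA.finite_ker.subset fun P hP ↦ ?_
    have hP' : σ • P = m • P := hP
    rw [SetLike.mem_coe, AddMonoidHom.mem_ker,
      show (χA.toAddMonoidHom : W.geomPoints →+ W.geomPoints) = π - (m : AddMonoid.End W.geomPoints)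
        from hχA]
    change π P - (m : AddMonoid.End W.geomPoints) P = 0
    rw [hπapp, AddMonoid.End.intCast_apply, hP', sub_self]
  have hBfin : {P : W.geomPoints | σ • P = -(m • P)}.Finite := by
    refine χB.finite_ker.subset fun P hP ↦ ?_
    have hP' : σ • P = -(m • P) := hP
    rw [SetLike.mem_coe, AddMonoidHom.mem_ker,
      show (χB.toAddMonoidHom : W.geomPoints →+ W.geomPoints) = π + (m : AddMonoid.End W.geomPoints)
        from hχB]
    change π P + (m : AddMonoid.End W.geomPoints) P = 0
    rw [hπapp, AddMonoid.End.intCast_apply, hP', neg_add_cancel]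
  -- the polynomial `G = X ^ q ΨSq_m - Φ_m` over `k̄`
  set L := AlgebraicClosure K with hL
  set V : WeierstrassCurve L := W.baseChange L with hV
  set G : L[X] := X ^ q * V.ΨSq m - V.Φ m with hG
  -- key: for an affine point `P = (x, y)` with `m P ≠ O`,
  -- `P ∈ A ⟹ G(x) = 0 ⟹ P ∈ A ∪ B`
  have key : ∀ {x y : L} (h : V.toAffine.Nonsingular x y) (P : W.geomPoints),
      P = Affine.Point.some x y h → m • P ≠ 0 →
      (σ • P = m • P → G.IsRoot x) ∧ (G.IsRoot x → σ • P = m • P ∨ σ • P = -(m • P)) := by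
    intro x y h P hPdef hm0
    subst hPdef
    have hψ : (V.ψ m).evalEval x y ≠ 0 := fun h0 ↦
      hm0 ((Affine.Point.zsmul_some_eq_zero_iff h m).mpr h0)
    obtain ⟨y₁, hns, e₁'⟩ := Affine.Point.zsmul_some_eq_some_φ_div h hψ
    -- the same identity with the scalar action of `E(k̄) = W.geomPoints`
    have e₁ : m • (show W.geomPoints from Affine.Point.some x y h) =
        (Affine.Point.some _ _ hns : W.geomPoints) := e₁'
    have hΨ : (V.ΨSq m).eval x ≠ 0 := by
      rw [← evalEval_ψ_sq V h.left]
      exact pow_ne_zero _ hψ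
    have hX₁ : (V.φ m).evalEval x y / (V.ψ m).evalEval x y ^ 2 =
        (V.Φ m).eval x / (V.ΨSq m).eval x := by
      rw [evalEval_φ_eq_eval_Φ V h.left, evalEval_ψ_sq V h.left]
    obtain ⟨h', e'⟩ := smul_some_eq_some W σ h
    have hσx : σ • x = x ^ q := hσ x
    have hroot : G.IsRoot x ↔ x ^ q = (V.Φ m).eval x / (V.ΨSq m).eval x := by
      rw [IsRoot.def, hG, eval_sub, eval_mul, eval_pow, eval_X, sub_eq_zero, eq_div_iff hΨ]
    refine ⟨fun heq ↦ ?_, fun hr ↦ ?_⟩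
    · rw [e', e₁] at heq
      have hx := (Affine.Point.some.injEq _ _ _ _ _ _).mp heq
      rw [hroot, ← hX₁, ← hx.1, hσx]
    · rw [hroot, ← hX₁, ← hσx] at hr
      rw [e', e₁]
      rcases Affine.Y_eq_of_X_eq h'.left hns.left hr with hy | hy
      · obtain ⟨h'', e''⟩ := Literature.NumberTheory.EllipticCurves.UnivEC.some_eq_some_of_eq hr hy h'
        exact Or.inl e''
      · -- `-(X₁, y₁) = (X₁, negY X₁ y₁)` definitionally (Mathlib `Affine.Point.neg_some` is `rfl`)
        obtain ⟨h'', e''⟩ := Literature.NumberTheory.EllipticCurves.UnivEC.some_eq_some_of_eq hr hy h'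
        exact Or.inr e''
  by_cases hG0 : G = 0
  · /- `G = 0`: every point off `E[m]` lies in `A ∪ B`, so `E[m] = E(k̄)`. -/
    have hcover : ∀ P : W.geomPoints, P ∉ geomTorsion W m →
        σ • P = m • P ∨ σ • P = -(m • P) := by
      intro P hP
      have hm0 : m • P ≠ 0 := fun h0 ↦ hP ((Submodule.mem_torsionBy_iff _ _).mpr h0)
      change (W.baseChange L).toAffine.Point at P
      rcases P with _ | ⟨x, y, h⟩
      · exact (hm0 (smul_zero m)).elim
      · exact (key h _ rfl hm0).2 (by rw [hG0]; exact IsRoot.def.mpr eval_zero)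
    have htop : geomTorsion W m = ⊤ := by
      refine Literature.NumberTheory.EllipticCurves.AddSubgroup.eq_top_of_finite_compl _ ((hAfin.union hBfin).subset fun P hP ↦ ?_)
      rcases hcover P hP with h | h
      · exact Or.inl h
      · exact Or.inr h
    have hP₁m : (m : ℤ) • P₁ = 0 :=
      (Submodule.mem_torsionBy_iff _ _).mp (htop ▸ AddSubgroup.mem_top P₁ : P₁ ∈ geomTorsion W m)
    -- `gcd(ℓ, m) = 1` kills `P₁`
    have hirr : Irreducible (ℓ : ℤ) := (Nat.prime_iff_prime_int.mp hℓp).irreducible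
    obtain ⟨a, b, hab⟩ := (Irreducible.coprime_iff_not_dvd hirr).mpr hℓm
    apply hP₁0
    calc P₁ = (1 : ℤ) • P₁ := (one_smul ℤ P₁).symm
      _ = (a * ℓ + b * m) • P₁ := by rw [hab]
      _ = 0 := by rw [add_smul, mul_smul, mul_smul, hP₁ℓ, hP₁m, smul_zero, smul_zero, add_zero]
  · /- `G ≠ 0`: `ℓ^{2N} = #E[ℓ^N] ≤ #A ≤ 1 + 2(q + m²)` contradicts `2|m| ≤ ℓ^N`, `ℓ^N > 4q + 2`. -/
    have hcardN : Nat.card (geomTorsion W (ℓ ^ N : ℕ)) = ℓ ^ (2 * N) :=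
      card_geomTorsion_pow_eq W ℓ (card_torsionPoints_eq_sq_holds W L) hℓ N
    -- the bound `#A ≤ 1 + 2 #roots(G)`
    have hAcard : {P : W.geomPoints | σ • P = m • P}.ncard ≤ 1 + 2 * (q + m.natAbs ^ 2) := by
      -- the Weierstrass quadratic above `x`
      set qx : L → L[X] := fun x ↦ V.toAffine.polynomial.map (evalRingHom x) with hqx
      have hqxdeg : ∀ x, (qx x).natDegree = 2 := fun x ↦ by
        simp only [hqx]
        rw [(V.toAffine.monic_polynomial).natDegree_map, Affine.natDegree_polynomial]
      -- the candidate coordinates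
      set T : Finset (L × L) :=
        G.roots.toFinset.biUnion fun x ↦ ((qx x).roots.toFinset.image (Prod.mk x)) with hT
      have hTcard : T.card ≤ 2 * G.natDegree := by
        calc T.card ≤ ∑ x ∈ G.roots.toFinset, ((qx x).roots.toFinset.image (Prod.mk x)).card :=
              Finset.card_biUnion_le
          _ ≤ ∑ x ∈ G.roots.toFinset, 2 := Finset.sum_le_sum fun x _ ↦
              Finset.card_image_le.trans ((Multiset.toFinset_card_le _).trans
                ((Polynomial.card_roots' _).trans (hqxdeg x).le))
          _ = 2 * G.roots.toFinset.card := by rw [Finset.sum_const, smul_eq_mul, mul_comm]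
          _ ≤ 2 * G.natDegree := Nat.mul_le_mul_left 2
              ((Multiset.toFinset_card_le _).trans (Polynomial.card_roots' G))
      have hGdeg : G.natDegree ≤ q + m.natAbs ^ 2 := by
        rw [hG]
        refine (natDegree_sub_le _ _).trans (max_le ?_ ?_)
        · refine natDegree_mul_le.trans ?_
          rw [natDegree_X_pow]
          have := V.natDegree_ΨSq_le m
          omega
        · exact (V.natDegree_Φ_le m).trans (Nat.le_add_left _ _)
      -- the coordinate map
      let f : W.geomPoints → Option (L × L) := fun P ↦
        match (P : (W.baseChange L).toAffine.Point) with
        | .zero => none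
        | .some x y _ => some (x, y)
      have hf : Set.InjOn f {P : W.geomPoints | σ • P = m • P} := by
        rintro P - Q - hPQ
        change (W.baseChange L).toAffine.Point at P Q
        rcases P with _ | ⟨x, y, h⟩ <;> rcases Q with _ | ⟨x', y', h'⟩
        · rfl
        · simp [f] at hPQ
        · simp [f] at hPQ
        · simp only [f, Option.some.injEq, Prod.mk.injEq] at hPQ
          obtain ⟨rfl, rfl⟩ := hPQ
          rfl
      have hfT : ∀ P ∈ {P : W.geomPoints | σ • P = m • P},
          f P ∈ insert none ((fun xy ↦ some xy) '' (T : Set (L × L))) := by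
        intro P hP
        have hP' : σ • P = m • P := hP
        by_cases hP0 : P = 0
        · subst hP0
          exact Set.mem_insert _ _
        have hm0 : m • P ≠ 0 := by
          rw [← hP']
          exact fun h0 ↦ hP0 ((smul_eq_zero_iff_eq σ).mp h0)
        change (W.baseChange L).toAffine.Point at P
        rcases P with _ | ⟨x, y, h⟩
        · exact absurd rfl hP0
        · have hx : G.IsRoot x := (key h _ rfl hm0).1 hP'
          refine Set.mem_insert_of_mem _ ⟨(x, y), ?_, rfl⟩
          rw [Finset.mem_coe, hT, Finset.mem_biUnion]
          refine ⟨x, Multiset.mem_toFinset.mpr ((mem_roots hG0).mpr hx), ?_⟩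
          refine Finset.mem_image_of_mem _ (Multiset.mem_toFinset.mpr ?_)
          refine (mem_roots (V.toAffine.monic_polynomial.map _).ne_zero).mpr ?_
          rw [IsRoot.def, map_evalRingHom_eval]
          exact h.left
      calc {P : W.geomPoints | σ • P = m • P}.ncard
          ≤ (insert none ((fun xy ↦ some xy) '' (T : Set (L × L)))).ncard :=
            Set.ncard_le_ncard_of_injOn f hfT hf (Set.toFinite _)
        _ ≤ ((fun xy ↦ some xy) '' (T : Set (L × L))).ncard + 1 := Set.ncard_insert_le _ _
        _ ≤ (T : Set (L × L)).ncard + 1 := by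
            gcongr
            exact Set.ncard_image_le (Finset.finite_toSet T)
        _ = T.card + 1 := by rw [Set.ncard_coe_finset]
        _ ≤ 1 + 2 * (q + m.natAbs ^ 2) := by
            have := hTcard.trans (Nat.mul_le_mul_left 2 hGdeg)
            omega
    -- `E[ℓ^N] ⊆ A`
    have hsub : ((geomTorsion W (ℓ ^ N : ℕ) : AddSubgroup W.geomPoints) : Set W.geomPoints) ⊆
        {P : W.geomPoints | σ • P = m • P} := fun P hP ↦ htor P hP
    have h1 : ℓ ^ (2 * N) ≤ 1 + 2 * (q + m.natAbs ^ 2) := by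
      rw [← hcardN, ← SetLike.coe_sort_coe, Nat.card_coe_set_eq]
      exact (Set.ncard_le_ncard hsub hAfin).trans hAcard
    -- arithmetic
    have h1' : (ℓ : ℤ) ^ (2 * N) ≤ 1 + 2 * (q + m ^ 2) := by
      rw [← Int.natAbs_sq m]
      exact_mod_cast h1
    have h2 : 4 * m ^ 2 ≤ (ℓ : ℤ) ^ (2 * N) := by
      have h0 : (0 : ℤ) ≤ 2 * |m| := by positivity
      have := pow_le_pow_left₀ h0 hm2 2
      rw [mul_pow, sq_abs, ← pow_mul, mul_comm N 2] at this
      linarith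
    have h3 : (4 * q + 2 : ℤ) < (ℓ : ℤ) ^ N := by exact_mod_cast hN
    have h4 : (ℓ : ℤ) ^ N ≤ (ℓ : ℤ) ^ (2 * N) :=
      pow_le_pow_right₀ (by exact_mod_cast hℓp.one_lt.le) (by omega)
    linarith

end Literature.AlgebraicGeometry.Motives
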